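import Mathlib
import HarnessLib
import Literature.MathematicalPhysics.StatisticalMechanics.InitialPolymerActivity
import Literature.MathematicalPhysics.StatisticalMechanics.FlowRepresentation
import Literature.MathematicalPhysics.StatisticalMechanics.FiniteRangeFactorisation
import Summits.HubbardSuperconductivity.HubbardSuperconductivity.Theorems.ComplexGFFStiffnessHypACumulantGreenMeasure

/-!
# Crux `HypACumulant`, line `gnv` — the partition function as the start of the renormalisation
# group flow: `pertZ n K = Z₀ · ∫ (K_0 ∘_0 e^{−0})(Λ, φ) μ(dφ)`, `μ = N(0, Σ_k circulant 𝒞_k)`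

Route `route-HubbardSuperconductivity-ComplexGFFStiffness`, crux item stmt-HubbardSuperconductivity-19154,
research stub `stub_gnvOfFrd : TorusFRD 4 → GNV`.  This file connects the object of `GNV`
(`pertZ n K`, `Theorems/ComplexGFFStiffnessDefs`) to the renormalisation group of
`Literature/…/RenormalisationMap` + `FlowRepresentation`:

* the finite-range decomposition kernels `𝒞_1, …, 𝒞_{N+1}` of the mean-zero Green's function
  (`TorusFRD` clauses (o), (i), (ii): zero sum, even, positive on mean-zero fields, summing to the
  inverse of `−Δ` on mean-zero fields) give `G = circulant(Σ_k 𝒞_k)` (g2: `sum_circulant_eq_greenMat_of_frd`)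
  and a positive semidefinite total kernel;
* **`pertZ_eq_mul_integral_flowStart`** — `pertZ n K = Z₀ · ∫ F_0 dμ` with
  `F_0(φ) = (K_0 ∘_0 e^{−0})(Λ, φ) = Σ_X ∏_{x∈X} K(∇φ(x))` (`InitialPolymerActivity`) and
  `μ = stepMeasure (Σ_k 𝒞_k) = tailMeasure 𝒞 N N` (`FlowRepresentation`), i.e. exactly the left-hand
  side of `integral_flow_eq`; here `Z₀ = ∫ e^{−S_0} > 0`.

So `GNV` (`pertZ n K ≠ 0`) is reduced to `∫ F_N dμ_{N+1} ≠ 0` for the flow `(H_k, K_k) = T_{k−1}⋯T_0(0, K_0)`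
once the step identities and their integrability are available (Ch. 9–12).  All proved; no `sorry`.

## References
* S. Adams, S. Buchholz, R. Kotecký, S. Müller, arXiv:1910.13564, Ch. 4.1–4.2 ((4.1)–(4.10))
  [AdamsBuchholzKoteckyMuller2019].
-/

noncomputable section

-- `Summit.<Summit>.<Problem>`: single-conjunct summit, the duplicate component is mandated (D-0017).
set_option linter.dupNamespace false

namespace Summit.HubbardSuperconductivity.HubbardSuperconductivity.Theorems.ComplexGFF

open scoped BigOperators Classical
open MeasureTheory Finset
open Literature.MathematicalPhysics.StatisticalMechanics.ComplexGradientGFF4 (D S)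
open Literature.MathematicalPhysics.StatisticalMechanics.GradientRG
open Literature.MathematicalPhysics.StatisticalMechanics.GradientFRD (ellOp conv)
open Literature.MathematicalPhysics.StatisticalMechanics.TorusPolymer (pcirc)
open Literature.Barriers.CriticalPhenomena.LongRangePhi4 (fieldGaussian)

variable {n : ℕ} [NeZero n]

omit [NeZero n] in
/-- The model's forward gradient is the tree's `gradAt`: `D φ i x = (gradAt x φ) i`. -/
theorem D_eq_gradAt (φ : (Fin 4 → ZMod n) → ℝ) (i : Fin 4) (x : Fin 4 → ZMod n) :
    D φ i x = gradAt x φ i := rfl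

omit [NeZero n] in
/-- The tail kernel of all `N+1` steps is the full sum `Σ_{k=1}^{N+1} 𝒞_k`. -/
theorem tailKernel_self (𝒞 : ℕ → (Fin 4 → ZMod n) → ℝ) (N : ℕ) :
    ∀ m, m ≤ N → tailKernel 𝒞 N m = fun x => ∑ k ∈ Finset.Icc (N + 1 - m) (N + 1), 𝒞 k x := by
  intro m
  induction m with
  | zero => intro _; funext x; simp [tailKernel]
  | succ m ih =>
    intro hm
    funext x
    rw [tailKernel, ih (by omega)]
    simp only [Pi.add_apply]
    have h : Finset.Icc (N + 1 - (m + 1)) (N + 1) = insert (N - m) (Finset.Icc (N + 1 - m) (N + 1)) := by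
      ext j; simp only [Finset.mem_Icc, Finset.mem_insert]; omega
    rw [h, Finset.sum_insert (by simp only [Finset.mem_Icc]; omega)]

/-- **The total kernel is positive semidefinite** (each `𝒞_k` zero-sum, even, positive on mean-zero
fields). -/
theorem posSemidef_circulant_sum {N : ℕ} {𝒞 : ℕ → (Fin 4 → ZMod n) → ℝ}
    (h0 : ∀ k ∈ Finset.Icc 1 (N + 1), ∑ x, 𝒞 k x = 0) (heven : ∀ k ∈ Finset.Icc 1 (N + 1), ∀ x, 𝒞 k (-x) = 𝒞 k x)
    (hpos : ∀ k ∈ Finset.Icc 1 (N + 1), ∀ φ : (Fin 4 → ZMod n) → ℝ, ∑ x, φ x = 0 →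
      0 ≤ ∑ x, ∑ y, φ x * 𝒞 k (x - y) * φ y) :
    (Matrix.circulant (fun x => ∑ k ∈ Finset.Icc 1 (N + 1), 𝒞 k x)).PosSemidef := by
  have hsum : Matrix.circulant (fun x => ∑ k ∈ Finset.Icc 1 (N + 1), 𝒞 k x) =
      ∑ k ∈ Finset.Icc 1 (N + 1), Matrix.circulant (𝒞 k) := by
    ext i j; simp [Matrix.sum_apply, Matrix.circulant_apply]
  rw [hsum]
  exact Matrix.posSemidef_sum _ fun k hk => posSemidef_circulant_of_sum_eq_zero (h0 k hk) (heven k hk) (hpos k hk)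

/-- **`pertZ` as the start of the flow.**  For kernels `𝒞_1, …, 𝒞_{N+1}` on `(ℤ/n)^4` with zero
sum, even, positive on mean-zero fields and whose sum inverts `−Δ` on mean-zero fields
(clauses (o), (i), (ii) of `GradientFRD.TorusFRD` at `A = 1`), and a continuous perturbation `K`:
`pertZ n K = Z₀ · ∫ (e^{−0} ∘_0 K_0)(Λ, φ) μ(dφ)`, `μ = tailMeasure 𝒞 N N = N(0, Σ_k circulant 𝒞_k)`,
`K_0 = initK K`, `Z₀ = ∫ e^{−S_0}` — the left-hand side of `integral_flow_eq`. -/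
theorem pertZ_eq_mul_integral_flowStart {N : ℕ} {𝒞 : ℕ → (Fin 4 → ZMod n) → ℝ}
    (h0 : ∀ k ∈ Finset.Icc 1 (N + 1), ∑ x, 𝒞 k x = 0)
    (heven : ∀ k ∈ Finset.Icc 1 (N + 1), ∀ x, 𝒞 k (-x) = 𝒞 k x)
    (hpos : ∀ k ∈ Finset.Icc 1 (N + 1), ∀ φ : (Fin 4 → ZMod n) → ℝ, ∑ x, φ x = 0 →
      0 ≤ ∑ x, ∑ y, φ x * 𝒞 k (x - y) * φ y)
    (hinv : ∀ φ : (Fin 4 → ZMod n) → ℝ, ∑ x, φ x = 0 →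
      ellOp (1 : Matrix (Fin 4) (Fin 4) ℝ) (conv (fun x => ∑ k ∈ Finset.Icc 1 (N + 1), 𝒞 k x) φ) = φ)
    {K : (Fin 4 → ℝ) → ℂ} (hK : Continuous K) :
    pertZ n K =
      ((∫ φ : (Fin 4 → ZMod n) → ℝ, Real.exp (-(S 0 φ)) : ℝ) : ℂ) *
        ∫ φ, pcirc 1 (fun V => expNegH (0 : RelevantHamiltonian ℂ 4) V φ) (fun U => initK K U φ)
          Finset.univ ∂(tailMeasure 𝒞 N N) := by
  rw [pertZ_eq_mul_integral_greenMat hK]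
  congr 1
  -- `G = circulant (Σ 𝒞_k)`
  have hG : greenMat n = Matrix.circulant (fun x => ∑ k ∈ Finset.Icc 1 (N + 1), 𝒞 k x) := by
    rw [← sum_circulant_eq_greenMat_of_frd 𝒞 h0 hinv]
    ext i j; simp [Matrix.sum_apply, Matrix.circulant_apply]
  have hC := posSemidef_circulant_sum h0 heven hpos
  -- the integrand as a function of the scalar field, and its measurability
  set F : ((Fin 4 → ZMod n) → ℝ) → ℂ := fun ψ =>
    pcirc 1 (fun V => expNegH (0 : RelevantHamiltonian ℂ 4) V ψ) (fun U => initK K U ψ) Finset.univ with hF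
  have hprod : ∀ ψ : (Fin 4 → ZMod n) → ℝ, (∏ x : Fin 4 → ZMod n, (1 + K (fun i => D ψ i x))) = F ψ := by
    intro ψ
    rw [hF]
    simp only [D_eq_gradAt]
    exact prod_one_add_eq_pcirc_initK K ψ
  have hcontF : Continuous F := by
    have : F = fun ψ => ∏ x : Fin 4 → ZMod n, (1 + K (fun i => D ψ i x)) := funext fun ψ => (hprod ψ).symm
    rw [this]
    have hD : ∀ (i : Fin 4) (x : Fin 4 → ZMod n), Continuous (fun φ : (Fin 4 → ZMod n) → ℝ => D φ i x) :=
      fun i x => by unfold D; fun_prop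
    exact continuous_finsetProd _ fun x _ => continuous_const.add (hK.comp (continuous_pi fun i => hD i x))
  simp_rw [hprod]
  -- pass from `P_G` on one-component fields to the step measure of the total kernel
  rw [tailMeasure, tailKernel_self 𝒞 N N le_rfl, show N + 1 - N = 1 by omega,
    integral_stepMeasure_eq_fieldGaussian hC hcontF.aestronglyMeasurable, hG]
  rfl

end Summit.HubbardSuperconductivity.HubbardSuperconductivity.Theorems.ComplexGFF

end
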